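/-
Copyright: the b2b-balaban T⁴-continuum CRUX team, row NE7b OWNER lineage `t4-ne7b-p1` (gen 136). Project licence.
-/
import Summits.QuantumFields.BalabanUV.T4Continuum.Spine.NE7b.SupEffectiveActionCovariance

/-!
# THE EXTRACTED QUADRATIC PART IS AN HONEST MATRIX, THE EXTRACTED LINEAR PART AN HONEST VECTOR — (α4), THE OBJECTS THE ABSORPTION
# STEP (385) CONSUMES: at every background `ψ₀`, the Hessian `Hess(−log Z)(ψ₀)` of the next potential ((319), a continuous bilinear map)
# is represented by the symmetric MATRIX `K_D(ψ₀)(x,y) = ½(Hess[e_x,e_y] + Hess[e_y,e_x])` (`e_x` the coordinate vectors): `vᵀK_Dv = Hess[v,v]`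
# for every `v`, which (320) writes as the covariance formula `⟨Σw″v²⟩_ν − Var_ν(Σw′v)`; the gradient `D(−log Z)(ψ₀)` ((313)) is the VECTOR
# `b_D(ψ₀)(x) = D(−log Z)(ψ₀)[e_x]` with `⟨b_D,v⟩ = Z⁻¹∫e^{−V}Σw′v`; and (320)'s two Hessian letters become the MATRIX LETTERS
#   `K_D + 2λ_w·1 ⪰ 0`  and  `Λ_w·1 − K_D ⪰ 0`
# — exactly the inputs `K`, `b`, `k = 2λ_w` of (385) `SupGaussianQuadraticAbsorption` ∕ (387) `SupDressedCovarianceLetters` (row NE7b, node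
# U5c; (313)∕(319)∕(320) BY NAME; [folklore])

Cell `pub-balaban`, sub-cell `t4`, spine estimate NE7b (`T4WeightBudget.RelWeightBound`; the cell's OWN estimate — NOT PRINTED in
[Bałaban 1983–89], NOT PROVED).  Crux-route work under `Spine/NE7b/` by the row OWNER (`t4-ne7b-p1` gen 136, file (388)) under FREEZE
(0)'s crux-prover clause, on gen 135's SCOPING-d7 DECISION (d7′)(2′)(a)∕(b) («`b_D = ∇W_D(0)` by (313); `K_D = Hess W_D(0)` by (319)∕(320)»);
NOTHING of Bałaban's is named as a Lean object, valued or asserted; no `T4Continuum/Support` leaf typed; no `def`, no notation (the matrix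
and the vector are WRITTEN OUT); zero `sorry`.  Imports (BY NAME): the OWNER's (320) `…SupEffectiveActionCovariance` (`hessian_neg_log_step_apply`,
`hessian_neg_log_step_ge`, `hessian_neg_log_step_le`) and through it (313) (`fderiv_neg_log_step_apply`), (297) (`cellSum_eq_sum_biUnion`);
Mathlib's `EuclideanSpace.basisFun`, `Matrix.PosSemidef.of_dotProduct_mulVec_nonneg`.

WHAT IS PROVED ([folklore]):
* §1 generic (any continuous bilinear `L`, linear `D` on `ℝ^ι`): `clm₂_apply_eq_form` (`L v u = vᵀ(L e_x e_y)_{xy}u`), `clm₁_apply_eq_dot`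
  (`D v = ⟨(D e_x)_x, v⟩`), `transpose_form_eq`, `symmMatrix_form_eq` (`vᵀ·½(L_{xy}+L_{yx})·v = L v v`), `symmMatrix_isHermitian`,
  `letters_of_form_bounds` (`−k(z·z) ≤ zᵀKz ≤ c(z·z)`, `K` symmetric ⟹ `K + k·1 ⪰ 0`, `c·1 − K ⪰ 0`), `cellSq_le_dotSelf` (`Σ_{C,cell}v² ≤ v·v`);
* §2 THE ROAD: **`nextGradient_apply`** (`⟨b_D(ψ₀),v⟩ = Z⁻¹∫e^{−V}Σ_{p,x}w′_x(ω_x+ψ₀,x)v_x`), **`nextHessianMatrix_apply`** (`vᵀK_D(ψ₀)v =` the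
  covariance formula of (320) at `(v,v)`), **`nextHessianMatrix_letters`** (THE END: `K_D` symmetric,
  `K_D + 2λ_w·1 ⪰ 0`, `Λ_w·1 − K_D ⪰ 0` under (316)∕(318)'s letters with `0 ≤ Λ_w`, over `N(0,M⁻¹)`); §3 toy.

HONEST (what this is NOT).  Linear algebra over (313)∕(319)∕(320): the letters `λ_w, Λ_w` are the remainders' second-order class constants
(hypotheses `hwlo`, `hwup`), `k = 2λ_w` is what (387) needs SMALL against the NEXT covariance (`2λ_wγ′ < 1`) — not discharged here; no locality
∕ finite range of `K_D` (that is (333)∕(334) `SupNextHessianLocality`∕`…RowSums`); scalar skeleton ((A3), NC-NE7b-α UNRULED); nothing of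
Bałaban's asserted.  BY-NAME EFFECT ON THE WALL: NONE.  NE7b NOT PRINTED ∕ NOT PROVED; spine PROVED 0∕9; rung (B)+1 — the programme's measures
remain FINITE-torus statements; NOT the mass gap, NOT Clay.  HONEST DEPENDENCY: continuum YM on T⁴ ⇐ BetaPertH ∧ nine spine estimates (0∕9
proved); BetaPertH ⇐ (D1) ∧ (D4) ∧ CAP+tail; G-an2-4 gates asym, D1 and NE2∕3∕4.
-/

set_option autoImplicit false
set_option maxSynthPendingDepth 2

noncomputable section

namespace Summit.QuantumFields.BalabanUV.T4Continuum.NE7b.SupNextHessianMatrix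

open MeasureTheory ProbabilityTheory Finset Real Matrix
open scoped BigOperators
open SupEffectiveActionCovariance (hessian_neg_log_step_apply hessian_neg_log_step_ge hessian_neg_log_step_le)
open SupEffectiveActionDerivative (fderiv_neg_log_step_apply)
open SupSmallFieldGasReal (cellSum_eq_sum_biUnion)

variable {ι : Type} [Fintype ι] [DecidableEq ι] {V : Type*}

/-! ## §1. Generic: bilinear and linear maps on `ℝ^ι` as matrices and vectors -/

/-- **A continuous bilinear map is its matrix on the coordinate vectors**: `L v u = Σ_{x,y} v_x·L(e_x)(e_y)·u_y`. [folklore] -/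
theorem clm₂_apply_eq_form (L : EuclideanSpace ℝ ι →L[ℝ] EuclideanSpace ℝ ι →L[ℝ] ℝ) (v u : EuclideanSpace ℝ ι) :
    L v u = (WithLp.ofLp v) ⬝ᵥ
      (Matrix.of fun x y : ι => L (EuclideanSpace.single x (1 : ℝ)) (EuclideanSpace.single y (1 : ℝ))) *ᵥ (WithLp.ofLp u) := by
  have hv := (EuclideanSpace.basisFun ι ℝ).sum_repr v
  have hu := (EuclideanSpace.basisFun ι ℝ).sum_repr u
  simp only [EuclideanSpace.basisFun_repr, EuclideanSpace.basisFun_apply] at hv hu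
  conv_lhs => rw [← hv, ← hu]
  simp only [map_sum, map_smul, _root_.sum_apply, _root_.smul_apply, smul_eq_mul]
  simp only [dotProduct, Matrix.mulVec, Matrix.of_apply, Finset.mul_sum]
  rw [Finset.sum_comm]
  refine Finset.sum_congr rfl fun x _ => Finset.sum_congr rfl fun y _ => ?_
  ring

/-- **A continuous linear functional is its vector on the coordinate vectors**: `D v = Σ_x D(e_x)·v_x`. [folklore] -/
theorem clm₁_apply_eq_dot (D : EuclideanSpace ℝ ι →L[ℝ] ℝ) (v : EuclideanSpace ℝ ι) :
    D v = (fun x : ι => D (EuclideanSpace.single x (1 : ℝ))) ⬝ᵥ (WithLp.ofLp v) := by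
  have hv := (EuclideanSpace.basisFun ι ℝ).sum_repr v
  simp only [EuclideanSpace.basisFun_repr, EuclideanSpace.basisFun_apply] at hv
  conv_lhs => rw [← hv]
  simp only [map_sum, map_smul, smul_eq_mul, dotProduct]
  refine Finset.sum_congr rfl fun x _ => ?_
  ring

omit [DecidableEq ι] in
/-- `vᵀMᵀv = vᵀMv`. [folklore] -/
theorem transpose_form_eq (M : Matrix ι ι ℝ) (v : ι → ℝ) : v ⬝ᵥ Mᵀ *ᵥ v = v ⬝ᵥ M *ᵥ v := by
  rw [Matrix.mulVec_transpose, dotProduct_comm, dotProduct_mulVec]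

/-- **The symmetrised matrix represents the quadratic form**: `vᵀ·½(L(e_x)(e_y) + L(e_y)(e_x))_{xy}·v = L v v`. [folklore] -/
theorem symmMatrix_form_eq (L : EuclideanSpace ℝ ι →L[ℝ] EuclideanSpace ℝ ι →L[ℝ] ℝ) (v : EuclideanSpace ℝ ι) :
    (WithLp.ofLp v) ⬝ᵥ (Matrix.of fun x y : ι =>
        (L (EuclideanSpace.single x (1 : ℝ)) (EuclideanSpace.single y (1 : ℝ)) +
          L (EuclideanSpace.single y (1 : ℝ)) (EuclideanSpace.single x (1 : ℝ))) / 2) *ᵥ (WithLp.ofLp v) = L v v := by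
  set A : Matrix ι ι ℝ := Matrix.of fun x y : ι => L (EuclideanSpace.single x (1 : ℝ)) (EuclideanSpace.single y (1 : ℝ)) with hA
  have hM : (Matrix.of fun x y : ι => (L (EuclideanSpace.single x (1 : ℝ)) (EuclideanSpace.single y (1 : ℝ)) +
      L (EuclideanSpace.single y (1 : ℝ)) (EuclideanSpace.single x (1 : ℝ))) / 2) = (2 : ℝ)⁻¹ • (A + Aᵀ) := by
    ext x y
    simp only [hA, Matrix.of_apply, Matrix.smul_apply, Matrix.add_apply, Matrix.transpose_apply, smul_eq_mul]
    ring
  rw [hM, smul_mulVec, dotProduct_smul, add_mulVec, dotProduct_add, transpose_form_eq, hA, ← clm₂_apply_eq_form, smul_eq_mul]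
  ring

omit [Fintype ι] [DecidableEq ι] in
/-- The symmetrised matrix is symmetric. [folklore] -/
theorem symmMatrix_isHermitian (f : ι → ι → ℝ) : (Matrix.of fun x y : ι => (f x y + f y x) / 2).IsHermitian := by
  refine Matrix.IsHermitian.ext fun x y => ?_
  simp only [Matrix.of_apply, star_trivial, add_comm]

/-- **Form bounds are matrix letters**: `K` symmetric, `−k(z·z) ≤ zᵀKz ≤ c(z·z)` for all `z` ⟹ `K + k·1 ⪰ 0` and `c·1 − K ⪰ 0`. [folklore] -/
theorem letters_of_form_bounds {K : Matrix ι ι ℝ} (hK : K.IsHermitian) {k c : ℝ} (hlow : ∀ z : ι → ℝ, -k * (z ⬝ᵥ z) ≤ z ⬝ᵥ K *ᵥ z)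
    (hup : ∀ z : ι → ℝ, z ⬝ᵥ K *ᵥ z ≤ c * (z ⬝ᵥ z)) :
    (K + k • (1 : Matrix ι ι ℝ)).PosSemidef ∧ (c • (1 : Matrix ι ι ℝ) - K).PosSemidef := by
  have h1 : ∀ r : ℝ, (r • (1 : Matrix ι ι ℝ)).IsHermitian := fun r => by
    rw [Matrix.IsHermitian, conjTranspose_smul, conjTranspose_one, star_trivial]
  refine ⟨PosSemidef.of_dotProduct_mulVec_nonneg (hK.add (h1 k)) fun z => ?_,
    PosSemidef.of_dotProduct_mulVec_nonneg ((h1 c).sub hK) fun z => ?_⟩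
  · rw [star_trivial, add_mulVec, dotProduct_add, smul_mulVec, one_mulVec, dotProduct_smul, smul_eq_mul]
    have := hlow z; linarith
  · rw [star_trivial, sub_mulVec, dotProduct_sub, smul_mulVec, one_mulVec, dotProduct_smul, smul_eq_mul]
    have := hup z; linarith

omit [DecidableEq ι] in
/-- `Σ_{p∈C}Σ_{x∈cell p}v_x² ≤ v·v` for disjoint cells. [folklore] -/
theorem cellSq_le_dotSelf (cell : V → Finset ι) (hdisj : ∀ p q, p ≠ q → Disjoint (cell p) (cell q)) (C : Finset V)
    (v : EuclideanSpace ℝ ι) : ∑ p ∈ C, ∑ x ∈ cell p, v x ^ 2 ≤ (WithLp.ofLp v) ⬝ᵥ (WithLp.ofLp v) := by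
  classical
  rw [cellSum_eq_sum_biUnion cell hdisj C (fun x => v x ^ 2)]
  have e : (WithLp.ofLp v) ⬝ᵥ (WithLp.ofLp v) = ∑ x, v x ^ 2 := by
    simp only [dotProduct, pow_two]
  rw [e]
  exact Finset.sum_le_univ_sum_of_nonneg fun x => sq_nonneg (v x)

/-! ## §2. THE ROAD: `b_D(ψ₀)` and `K_D(ψ₀)` -/

section Road

variable {cell : V → Finset ι} {w w' w'' : ι → ℝ → ℝ} {κ₀ κ₁ κ₂ τ δ θ : ℝ}

/-- **THE EXTRACTED LINEAR PART IS THE VECTOR `b_D(ψ₀)(x) = D(−log Z)(ψ₀)[e_x]`**: under (313)'s hypotheses, for every direction `v`,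
`⟨b_D(ψ₀), v⟩ = Z(ψ₀)⁻¹·∫e^{−V(ψ₀,ω)}Σ_{p∈C}Σ_{x∈cell p}w′_x(ω_x+ψ₀,x)v_x dN(0,Γ)`. [folklore] -/
theorem nextGradient_apply {Γ : Matrix ι ι ℝ} {γop : ℝ} (hΓ : Γ.PosSemidef) (hΓop : (γop • (1 : Matrix ι ι ℝ) - Γ).PosSemidef)
    (hdisj : ∀ p q, p ≠ q → Disjoint (cell p) (cell q)) (hw' : ∀ x t, HasDerivAt (w x) (w' x t) t) (hw'm : ∀ x, Measurable (w' x))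
    (hκ₀ : 0 ≤ κ₀) (hκ₁ : 0 ≤ κ₁) (hτ : 0 < τ) (hδ : 0 < δ) (hθ1 : θ < 1)
    (hκθ : (2 * κ₀ * (1 + τ) + 4 * δ) * γop ≤ θ) (hstab : ∀ x, ∀ t : ℝ, -(κ₀ * t ^ 2) ≤ w x t)
    (hw'b : ∀ x t, |w' x t| ≤ κ₁ * |t|) (C : Finset V) (ψ₀ v : EuclideanSpace ℝ ι) :
    (fun x : ι => (((∫ ω : EuclideanSpace ℝ ι, exp (-(∑ p ∈ C, ∑ x ∈ cell p, w x (ω x + ψ₀ x))) ∂(multivariateGaussian 0 Γ))⁻¹ •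
        ∫ ω : EuclideanSpace ℝ ι, exp (-(∑ p ∈ C, ∑ x ∈ cell p, w x (ω x + ψ₀ x))) •
          (∑ p ∈ C, ∑ x ∈ cell p, (w' x (ω x + ψ₀ x)) • (EuclideanSpace.proj x : EuclideanSpace ℝ ι →L[ℝ] ℝ))
          ∂(multivariateGaussian 0 Γ))) (EuclideanSpace.single x (1 : ℝ))) ⬝ᵥ (WithLp.ofLp v) =
      (∫ ω : EuclideanSpace ℝ ι, exp (-(∑ p ∈ C, ∑ x ∈ cell p, w x (ω x + ψ₀ x))) ∂(multivariateGaussian 0 Γ))⁻¹ *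
        ∫ ω : EuclideanSpace ℝ ι, exp (-(∑ p ∈ C, ∑ x ∈ cell p, w x (ω x + ψ₀ x))) *
          (∑ p ∈ C, ∑ x ∈ cell p, w' x (ω x + ψ₀ x) * v x) ∂(multivariateGaussian 0 Γ) := by
  rw [← clm₁_apply_eq_dot]
  exact fderiv_neg_log_step_apply hΓ hΓop hdisj hw' hw'm hκ₀ hκ₁ hτ hδ hθ1 hκθ hstab hw'b C ψ₀ v

/-- **THE EXTRACTED QUADRATIC PART IS THE MATRIX `K_D(ψ₀)`, AND ITS FORM IS THE COVARIANCE FORMULA**: under (320)'s hypotheses, for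
every direction `v`, `vᵀK_D(ψ₀)v = Z⁻¹∫e^{−V}(Σw″v² − (Σw′v)²) + Z⁻²(∫e^{−V}Σw′v)²` (`= ⟨Σw″v²⟩_ν − Var_ν(Σw′v)`). [folklore] -/
theorem nextHessianMatrix_apply {Γ : Matrix ι ι ℝ} {γop : ℝ} (hΓ : Γ.PosSemidef) (hΓop : (γop • (1 : Matrix ι ι ℝ) - Γ).PosSemidef)
    (hdisj : ∀ p q, p ≠ q → Disjoint (cell p) (cell q)) (hw' : ∀ x t, HasDerivAt (w x) (w' x t) t) (hw'm : ∀ x, Measurable (w' x))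
    (hw''m : ∀ x, Measurable (w'' x)) (hκ₀ : 0 ≤ κ₀) (hκ₁ : 0 ≤ κ₁) (hτ : 0 < τ) (hδ : 0 < δ) (hθ1 : θ < 1)
    (hκθ : (2 * κ₀ * (1 + τ) + 4 * δ) * γop ≤ θ) (hstab : ∀ x, ∀ t : ℝ, -(κ₀ * t ^ 2) ≤ w x t) (hw'b : ∀ x t, |w' x t| ≤ κ₁ * |t|)
    (hw''b : ∀ x t, |w'' x t| ≤ κ₂) (C : Finset V) (ψ₀ v : EuclideanSpace ℝ ι) :
    (WithLp.ofLp v) ⬝ᵥ (Matrix.of fun x y : ι =>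
      ((((∫ ω : EuclideanSpace ℝ ι, exp (-(∑ p ∈ C, ∑ x ∈ cell p, w x (ω x + ψ₀ x))) ∂(multivariateGaussian 0 Γ))⁻¹ •
          (∫ ω : EuclideanSpace ℝ ι, exp (-(∑ p ∈ C, ∑ x ∈ cell p, w x (ω x + ψ₀ x))) •
            ((∑ p ∈ C, ∑ x ∈ cell p, (w'' x (ω x + ψ₀ x)) • ((EuclideanSpace.proj x : EuclideanSpace ℝ ι →L[ℝ] ℝ).smulRight
                (EuclideanSpace.proj x : EuclideanSpace ℝ ι →L[ℝ] ℝ))) -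
              (∑ p ∈ C, ∑ x ∈ cell p, (w' x (ω x + ψ₀ x)) • (EuclideanSpace.proj x : EuclideanSpace ℝ ι →L[ℝ] ℝ)).smulRight
                (∑ p ∈ C, ∑ x ∈ cell p, (w' x (ω x + ψ₀ x)) • (EuclideanSpace.proj x : EuclideanSpace ℝ ι →L[ℝ] ℝ)))
            ∂(multivariateGaussian 0 Γ)) +
        (((∫ ω : EuclideanSpace ℝ ι, exp (-(∑ p ∈ C, ∑ x ∈ cell p, w x (ω x + ψ₀ x))) ∂(multivariateGaussian 0 Γ)) ^ 2)⁻¹ •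
          ∫ ω : EuclideanSpace ℝ ι, exp (-(∑ p ∈ C, ∑ x ∈ cell p, w x (ω x + ψ₀ x))) •
            (∑ p ∈ C, ∑ x ∈ cell p, (w' x (ω x + ψ₀ x)) • (EuclideanSpace.proj x : EuclideanSpace ℝ ι →L[ℝ] ℝ))
            ∂(multivariateGaussian 0 Γ)).smulRight
          (∫ ω : EuclideanSpace ℝ ι, exp (-(∑ p ∈ C, ∑ x ∈ cell p, w x (ω x + ψ₀ x))) •
            (∑ p ∈ C, ∑ x ∈ cell p, (w' x (ω x + ψ₀ x)) • (EuclideanSpace.proj x : EuclideanSpace ℝ ι →L[ℝ] ℝ))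
            ∂(multivariateGaussian 0 Γ)))
          (EuclideanSpace.single x (1 : ℝ)) (EuclideanSpace.single y (1 : ℝ)) +
        ((∫ ω : EuclideanSpace ℝ ι, exp (-(∑ p ∈ C, ∑ x ∈ cell p, w x (ω x + ψ₀ x))) ∂(multivariateGaussian 0 Γ))⁻¹ •
          (∫ ω : EuclideanSpace ℝ ι, exp (-(∑ p ∈ C, ∑ x ∈ cell p, w x (ω x + ψ₀ x))) •
            ((∑ p ∈ C, ∑ x ∈ cell p, (w'' x (ω x + ψ₀ x)) • ((EuclideanSpace.proj x : EuclideanSpace ℝ ι →L[ℝ] ℝ).smulRight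
                (EuclideanSpace.proj x : EuclideanSpace ℝ ι →L[ℝ] ℝ))) -
              (∑ p ∈ C, ∑ x ∈ cell p, (w' x (ω x + ψ₀ x)) • (EuclideanSpace.proj x : EuclideanSpace ℝ ι →L[ℝ] ℝ)).smulRight
                (∑ p ∈ C, ∑ x ∈ cell p, (w' x (ω x + ψ₀ x)) • (EuclideanSpace.proj x : EuclideanSpace ℝ ι →L[ℝ] ℝ)))
            ∂(multivariateGaussian 0 Γ)) +
        (((∫ ω : EuclideanSpace ℝ ι, exp (-(∑ p ∈ C, ∑ x ∈ cell p, w x (ω x + ψ₀ x))) ∂(multivariateGaussian 0 Γ)) ^ 2)⁻¹ •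
          ∫ ω : EuclideanSpace ℝ ι, exp (-(∑ p ∈ C, ∑ x ∈ cell p, w x (ω x + ψ₀ x))) •
            (∑ p ∈ C, ∑ x ∈ cell p, (w' x (ω x + ψ₀ x)) • (EuclideanSpace.proj x : EuclideanSpace ℝ ι →L[ℝ] ℝ))
            ∂(multivariateGaussian 0 Γ)).smulRight
          (∫ ω : EuclideanSpace ℝ ι, exp (-(∑ p ∈ C, ∑ x ∈ cell p, w x (ω x + ψ₀ x))) •
            (∑ p ∈ C, ∑ x ∈ cell p, (w' x (ω x + ψ₀ x)) • (EuclideanSpace.proj x : EuclideanSpace ℝ ι →L[ℝ] ℝ))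
            ∂(multivariateGaussian 0 Γ)))
          (EuclideanSpace.single y (1 : ℝ)) (EuclideanSpace.single x (1 : ℝ))) / 2)) *ᵥ (WithLp.ofLp v) =
      (∫ ω : EuclideanSpace ℝ ι, exp (-(∑ p ∈ C, ∑ x ∈ cell p, w x (ω x + ψ₀ x))) ∂(multivariateGaussian 0 Γ))⁻¹ *
          ∫ ω : EuclideanSpace ℝ ι, exp (-(∑ p ∈ C, ∑ x ∈ cell p, w x (ω x + ψ₀ x))) *
            (∑ p ∈ C, ∑ x ∈ cell p, w'' x (ω x + ψ₀ x) * v x * v x -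
              (∑ p ∈ C, ∑ x ∈ cell p, w' x (ω x + ψ₀ x) * v x) * (∑ p ∈ C, ∑ x ∈ cell p, w' x (ω x + ψ₀ x) * v x))
            ∂(multivariateGaussian 0 Γ) +
        (((∫ ω : EuclideanSpace ℝ ι, exp (-(∑ p ∈ C, ∑ x ∈ cell p, w x (ω x + ψ₀ x))) ∂(multivariateGaussian 0 Γ)) ^ 2)⁻¹ *
          ((∫ ω : EuclideanSpace ℝ ι, exp (-(∑ p ∈ C, ∑ x ∈ cell p, w x (ω x + ψ₀ x))) *
              (∑ p ∈ C, ∑ x ∈ cell p, w' x (ω x + ψ₀ x) * v x) ∂(multivariateGaussian 0 Γ)) *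
            ∫ ω : EuclideanSpace ℝ ι, exp (-(∑ p ∈ C, ∑ x ∈ cell p, w x (ω x + ψ₀ x))) *
              (∑ p ∈ C, ∑ x ∈ cell p, w' x (ω x + ψ₀ x) * v x) ∂(multivariateGaussian 0 Γ))) := by
  rw [symmMatrix_form_eq]
  exact hessian_neg_log_step_apply hΓ hΓop hdisj hw' hw'm hw''m hκ₀ hκ₁ hτ hδ hθ1 hκθ hstab hw'b hw''b C ψ₀ v v

/-- **THE END — THE MATRIX LETTERS OF THE EXTRACTED QUADRATIC PART.**  Over `N(0,M⁻¹)` with `M ≻ 0` of floor `m`, `M⁻¹ ⪯ γ_op·1`,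
disjoint cells, `C²` remainders with `|w′| ≤ κ₁|t|`, `|w″| ≤ κ₂`, `−κ₀t² ≤ w ≤ κ₀t²`, the two second-order class letters `λ_w ≥ 0` (lower,
`2λ_w ≤ m`) and `Λ_w ≥ 0` (upper), and the regulator margins of (316)∕(318): at EVERY `ψ₀`, the matrix `K_D(ψ₀)` (which represents the Hessian,
`vᵀK_Dv = Hess(−log Z)(ψ₀)[v,v]`, by `symmMatrix_form_eq` ∕ `nextHessianMatrix_apply`) is symmetric and  `K_D + 2λ_w·1 ⪰ 0`,  `Λ_w·1 − K_D ⪰ 0`.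
[folklore] -/
theorem nextHessianMatrix_letters {M : Matrix ι ι ℝ} {γop m lamw Λw : ℝ} (hM : M.PosDef)
    (hfl : ∀ z : ι → ℝ, m * ∑ i, z i ^ 2 ≤ z ⬝ᵥ (M *ᵥ z)) (hΓop : (γop • (1 : Matrix ι ι ℝ) - M⁻¹).PosSemidef)
    (hdisj : ∀ p q, p ≠ q → Disjoint (cell p) (cell q)) (hw' : ∀ x t, HasDerivAt (w x) (w' x t) t)
    (hw'' : ∀ x t, HasDerivAt (w' x) (w'' x t) t) (hw'm : ∀ x, Measurable (w' x)) (hw''m : ∀ x, Measurable (w'' x))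
    (hκ₀ : 0 ≤ κ₀) (hκ₁ : 0 ≤ κ₁) (hτ : 0 < τ) (hδ : 0 < δ) (hθ0 : 0 < θ) (hθ1 : θ < 1) (hκθ : (2 * κ₀ * (1 + τ) + 4 * δ) * γop ≤ θ)
    (hκθ₆ : 6 * κ₀ * (1 + τ) * γop ≤ θ) (hstab : ∀ x, ∀ t : ℝ, -(κ₀ * t ^ 2) ≤ w x t) (hquad : ∀ x, ∀ t : ℝ, w x t ≤ κ₀ * t ^ 2)
    (hw'b : ∀ x t, |w' x t| ≤ κ₁ * |t|) (hw''b : ∀ x t, |w'' x t| ≤ κ₂) (hlamw : 0 ≤ lamw) (hΛw : 0 ≤ Λw)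
    (hwlo : ∀ u (a b : ℝ), w u a + w' u a * (b - a) - lamw / 2 * (b - a) ^ 2 ≤ w u b)
    (hwup : ∀ x (a b : ℝ), w x b ≤ w x a + w' x a * (b - a) + Λw / 2 * (b - a) ^ 2) (hm : 2 * lamw ≤ m) (C : Finset V)
    (ψ₀ : EuclideanSpace ℝ ι) :
    (Matrix.of fun x y : ι =>
      ((((∫ ω : EuclideanSpace ℝ ι, exp (-(∑ p ∈ C, ∑ x ∈ cell p, w x (ω x + ψ₀ x))) ∂(multivariateGaussian 0 M⁻¹))⁻¹ •
          (∫ ω : EuclideanSpace ℝ ι, exp (-(∑ p ∈ C, ∑ x ∈ cell p, w x (ω x + ψ₀ x))) •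
            ((∑ p ∈ C, ∑ x ∈ cell p, (w'' x (ω x + ψ₀ x)) • ((EuclideanSpace.proj x : EuclideanSpace ℝ ι →L[ℝ] ℝ).smulRight
                (EuclideanSpace.proj x : EuclideanSpace ℝ ι →L[ℝ] ℝ))) -
              (∑ p ∈ C, ∑ x ∈ cell p, (w' x (ω x + ψ₀ x)) • (EuclideanSpace.proj x : EuclideanSpace ℝ ι →L[ℝ] ℝ)).smulRight
                (∑ p ∈ C, ∑ x ∈ cell p, (w' x (ω x + ψ₀ x)) • (EuclideanSpace.proj x : EuclideanSpace ℝ ι →L[ℝ] ℝ)))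
            ∂(multivariateGaussian 0 M⁻¹)) +
        (((∫ ω : EuclideanSpace ℝ ι, exp (-(∑ p ∈ C, ∑ x ∈ cell p, w x (ω x + ψ₀ x))) ∂(multivariateGaussian 0 M⁻¹)) ^ 2)⁻¹ •
          ∫ ω : EuclideanSpace ℝ ι, exp (-(∑ p ∈ C, ∑ x ∈ cell p, w x (ω x + ψ₀ x))) •
            (∑ p ∈ C, ∑ x ∈ cell p, (w' x (ω x + ψ₀ x)) • (EuclideanSpace.proj x : EuclideanSpace ℝ ι →L[ℝ] ℝ))
            ∂(multivariateGaussian 0 M⁻¹)).smulRight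
          (∫ ω : EuclideanSpace ℝ ι, exp (-(∑ p ∈ C, ∑ x ∈ cell p, w x (ω x + ψ₀ x))) •
            (∑ p ∈ C, ∑ x ∈ cell p, (w' x (ω x + ψ₀ x)) • (EuclideanSpace.proj x : EuclideanSpace ℝ ι →L[ℝ] ℝ))
            ∂(multivariateGaussian 0 M⁻¹)))
          (EuclideanSpace.single x (1 : ℝ)) (EuclideanSpace.single y (1 : ℝ)) +
        ((∫ ω : EuclideanSpace ℝ ι, exp (-(∑ p ∈ C, ∑ x ∈ cell p, w x (ω x + ψ₀ x))) ∂(multivariateGaussian 0 M⁻¹))⁻¹ •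
          (∫ ω : EuclideanSpace ℝ ι, exp (-(∑ p ∈ C, ∑ x ∈ cell p, w x (ω x + ψ₀ x))) •
            ((∑ p ∈ C, ∑ x ∈ cell p, (w'' x (ω x + ψ₀ x)) • ((EuclideanSpace.proj x : EuclideanSpace ℝ ι →L[ℝ] ℝ).smulRight
                (EuclideanSpace.proj x : EuclideanSpace ℝ ι →L[ℝ] ℝ))) -
              (∑ p ∈ C, ∑ x ∈ cell p, (w' x (ω x + ψ₀ x)) • (EuclideanSpace.proj x : EuclideanSpace ℝ ι →L[ℝ] ℝ)).smulRight
                (∑ p ∈ C, ∑ x ∈ cell p, (w' x (ω x + ψ₀ x)) • (EuclideanSpace.proj x : EuclideanSpace ℝ ι →L[ℝ] ℝ)))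
            ∂(multivariateGaussian 0 M⁻¹)) +
        (((∫ ω : EuclideanSpace ℝ ι, exp (-(∑ p ∈ C, ∑ x ∈ cell p, w x (ω x + ψ₀ x))) ∂(multivariateGaussian 0 M⁻¹)) ^ 2)⁻¹ •
          ∫ ω : EuclideanSpace ℝ ι, exp (-(∑ p ∈ C, ∑ x ∈ cell p, w x (ω x + ψ₀ x))) •
            (∑ p ∈ C, ∑ x ∈ cell p, (w' x (ω x + ψ₀ x)) • (EuclideanSpace.proj x : EuclideanSpace ℝ ι →L[ℝ] ℝ))
            ∂(multivariateGaussian 0 M⁻¹)).smulRight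
          (∫ ω : EuclideanSpace ℝ ι, exp (-(∑ p ∈ C, ∑ x ∈ cell p, w x (ω x + ψ₀ x))) •
            (∑ p ∈ C, ∑ x ∈ cell p, (w' x (ω x + ψ₀ x)) • (EuclideanSpace.proj x : EuclideanSpace ℝ ι →L[ℝ] ℝ))
            ∂(multivariateGaussian 0 M⁻¹)))
          (EuclideanSpace.single y (1 : ℝ)) (EuclideanSpace.single x (1 : ℝ))) / 2)).IsHermitian ∧
      ((Matrix.of fun x y : ι =>
      ((((∫ ω : EuclideanSpace ℝ ι, exp (-(∑ p ∈ C, ∑ x ∈ cell p, w x (ω x + ψ₀ x))) ∂(multivariateGaussian 0 M⁻¹))⁻¹ •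
          (∫ ω : EuclideanSpace ℝ ι, exp (-(∑ p ∈ C, ∑ x ∈ cell p, w x (ω x + ψ₀ x))) •
            ((∑ p ∈ C, ∑ x ∈ cell p, (w'' x (ω x + ψ₀ x)) • ((EuclideanSpace.proj x : EuclideanSpace ℝ ι →L[ℝ] ℝ).smulRight
                (EuclideanSpace.proj x : EuclideanSpace ℝ ι →L[ℝ] ℝ))) -
              (∑ p ∈ C, ∑ x ∈ cell p, (w' x (ω x + ψ₀ x)) • (EuclideanSpace.proj x : EuclideanSpace ℝ ι →L[ℝ] ℝ)).smulRight
                (∑ p ∈ C, ∑ x ∈ cell p, (w' x (ω x + ψ₀ x)) • (EuclideanSpace.proj x : EuclideanSpace ℝ ι →L[ℝ] ℝ)))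
            ∂(multivariateGaussian 0 M⁻¹)) +
        (((∫ ω : EuclideanSpace ℝ ι, exp (-(∑ p ∈ C, ∑ x ∈ cell p, w x (ω x + ψ₀ x))) ∂(multivariateGaussian 0 M⁻¹)) ^ 2)⁻¹ •
          ∫ ω : EuclideanSpace ℝ ι, exp (-(∑ p ∈ C, ∑ x ∈ cell p, w x (ω x + ψ₀ x))) •
            (∑ p ∈ C, ∑ x ∈ cell p, (w' x (ω x + ψ₀ x)) • (EuclideanSpace.proj x : EuclideanSpace ℝ ι →L[ℝ] ℝ))
            ∂(multivariateGaussian 0 M⁻¹)).smulRight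
          (∫ ω : EuclideanSpace ℝ ι, exp (-(∑ p ∈ C, ∑ x ∈ cell p, w x (ω x + ψ₀ x))) •
            (∑ p ∈ C, ∑ x ∈ cell p, (w' x (ω x + ψ₀ x)) • (EuclideanSpace.proj x : EuclideanSpace ℝ ι →L[ℝ] ℝ))
            ∂(multivariateGaussian 0 M⁻¹)))
          (EuclideanSpace.single x (1 : ℝ)) (EuclideanSpace.single y (1 : ℝ)) +
        ((∫ ω : EuclideanSpace ℝ ι, exp (-(∑ p ∈ C, ∑ x ∈ cell p, w x (ω x + ψ₀ x))) ∂(multivariateGaussian 0 M⁻¹))⁻¹ •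
          (∫ ω : EuclideanSpace ℝ ι, exp (-(∑ p ∈ C, ∑ x ∈ cell p, w x (ω x + ψ₀ x))) •
            ((∑ p ∈ C, ∑ x ∈ cell p, (w'' x (ω x + ψ₀ x)) • ((EuclideanSpace.proj x : EuclideanSpace ℝ ι →L[ℝ] ℝ).smulRight
                (EuclideanSpace.proj x : EuclideanSpace ℝ ι →L[ℝ] ℝ))) -
              (∑ p ∈ C, ∑ x ∈ cell p, (w' x (ω x + ψ₀ x)) • (EuclideanSpace.proj x : EuclideanSpace ℝ ι →L[ℝ] ℝ)).smulRight
                (∑ p ∈ C, ∑ x ∈ cell p, (w' x (ω x + ψ₀ x)) • (EuclideanSpace.proj x : EuclideanSpace ℝ ι →L[ℝ] ℝ)))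
            ∂(multivariateGaussian 0 M⁻¹)) +
        (((∫ ω : EuclideanSpace ℝ ι, exp (-(∑ p ∈ C, ∑ x ∈ cell p, w x (ω x + ψ₀ x))) ∂(multivariateGaussian 0 M⁻¹)) ^ 2)⁻¹ •
          ∫ ω : EuclideanSpace ℝ ι, exp (-(∑ p ∈ C, ∑ x ∈ cell p, w x (ω x + ψ₀ x))) •
            (∑ p ∈ C, ∑ x ∈ cell p, (w' x (ω x + ψ₀ x)) • (EuclideanSpace.proj x : EuclideanSpace ℝ ι →L[ℝ] ℝ))
            ∂(multivariateGaussian 0 M⁻¹)).smulRight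
          (∫ ω : EuclideanSpace ℝ ι, exp (-(∑ p ∈ C, ∑ x ∈ cell p, w x (ω x + ψ₀ x))) •
            (∑ p ∈ C, ∑ x ∈ cell p, (w' x (ω x + ψ₀ x)) • (EuclideanSpace.proj x : EuclideanSpace ℝ ι →L[ℝ] ℝ))
            ∂(multivariateGaussian 0 M⁻¹)))
          (EuclideanSpace.single y (1 : ℝ)) (EuclideanSpace.single x (1 : ℝ))) / 2)) + (2 * lamw) • (1 : Matrix ι ι ℝ)).PosSemidef ∧
      (Λw • (1 : Matrix ι ι ℝ) - (Matrix.of fun x y : ι =>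
      ((((∫ ω : EuclideanSpace ℝ ι, exp (-(∑ p ∈ C, ∑ x ∈ cell p, w x (ω x + ψ₀ x))) ∂(multivariateGaussian 0 M⁻¹))⁻¹ •
          (∫ ω : EuclideanSpace ℝ ι, exp (-(∑ p ∈ C, ∑ x ∈ cell p, w x (ω x + ψ₀ x))) •
            ((∑ p ∈ C, ∑ x ∈ cell p, (w'' x (ω x + ψ₀ x)) • ((EuclideanSpace.proj x : EuclideanSpace ℝ ι →L[ℝ] ℝ).smulRight
                (EuclideanSpace.proj x : EuclideanSpace ℝ ι →L[ℝ] ℝ))) -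
              (∑ p ∈ C, ∑ x ∈ cell p, (w' x (ω x + ψ₀ x)) • (EuclideanSpace.proj x : EuclideanSpace ℝ ι →L[ℝ] ℝ)).smulRight
                (∑ p ∈ C, ∑ x ∈ cell p, (w' x (ω x + ψ₀ x)) • (EuclideanSpace.proj x : EuclideanSpace ℝ ι →L[ℝ] ℝ)))
            ∂(multivariateGaussian 0 M⁻¹)) +
        (((∫ ω : EuclideanSpace ℝ ι, exp (-(∑ p ∈ C, ∑ x ∈ cell p, w x (ω x + ψ₀ x))) ∂(multivariateGaussian 0 M⁻¹)) ^ 2)⁻¹ •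
          ∫ ω : EuclideanSpace ℝ ι, exp (-(∑ p ∈ C, ∑ x ∈ cell p, w x (ω x + ψ₀ x))) •
            (∑ p ∈ C, ∑ x ∈ cell p, (w' x (ω x + ψ₀ x)) • (EuclideanSpace.proj x : EuclideanSpace ℝ ι →L[ℝ] ℝ))
            ∂(multivariateGaussian 0 M⁻¹)).smulRight
          (∫ ω : EuclideanSpace ℝ ι, exp (-(∑ p ∈ C, ∑ x ∈ cell p, w x (ω x + ψ₀ x))) •
            (∑ p ∈ C, ∑ x ∈ cell p, (w' x (ω x + ψ₀ x)) • (EuclideanSpace.proj x : EuclideanSpace ℝ ι →L[ℝ] ℝ))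
            ∂(multivariateGaussian 0 M⁻¹)))
          (EuclideanSpace.single x (1 : ℝ)) (EuclideanSpace.single y (1 : ℝ)) +
        ((∫ ω : EuclideanSpace ℝ ι, exp (-(∑ p ∈ C, ∑ x ∈ cell p, w x (ω x + ψ₀ x))) ∂(multivariateGaussian 0 M⁻¹))⁻¹ •
          (∫ ω : EuclideanSpace ℝ ι, exp (-(∑ p ∈ C, ∑ x ∈ cell p, w x (ω x + ψ₀ x))) •
            ((∑ p ∈ C, ∑ x ∈ cell p, (w'' x (ω x + ψ₀ x)) • ((EuclideanSpace.proj x : EuclideanSpace ℝ ι →L[ℝ] ℝ).smulRight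
                (EuclideanSpace.proj x : EuclideanSpace ℝ ι →L[ℝ] ℝ))) -
              (∑ p ∈ C, ∑ x ∈ cell p, (w' x (ω x + ψ₀ x)) • (EuclideanSpace.proj x : EuclideanSpace ℝ ι →L[ℝ] ℝ)).smulRight
                (∑ p ∈ C, ∑ x ∈ cell p, (w' x (ω x + ψ₀ x)) • (EuclideanSpace.proj x : EuclideanSpace ℝ ι →L[ℝ] ℝ)))
            ∂(multivariateGaussian 0 M⁻¹)) +
        (((∫ ω : EuclideanSpace ℝ ι, exp (-(∑ p ∈ C, ∑ x ∈ cell p, w x (ω x + ψ₀ x))) ∂(multivariateGaussian 0 M⁻¹)) ^ 2)⁻¹ •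
          ∫ ω : EuclideanSpace ℝ ι, exp (-(∑ p ∈ C, ∑ x ∈ cell p, w x (ω x + ψ₀ x))) •
            (∑ p ∈ C, ∑ x ∈ cell p, (w' x (ω x + ψ₀ x)) • (EuclideanSpace.proj x : EuclideanSpace ℝ ι →L[ℝ] ℝ))
            ∂(multivariateGaussian 0 M⁻¹)).smulRight
          (∫ ω : EuclideanSpace ℝ ι, exp (-(∑ p ∈ C, ∑ x ∈ cell p, w x (ω x + ψ₀ x))) •
            (∑ p ∈ C, ∑ x ∈ cell p, (w' x (ω x + ψ₀ x)) • (EuclideanSpace.proj x : EuclideanSpace ℝ ι →L[ℝ] ℝ))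
            ∂(multivariateGaussian 0 M⁻¹)))
          (EuclideanSpace.single y (1 : ℝ)) (EuclideanSpace.single x (1 : ℝ))) / 2))).PosSemidef := by
  have hΓ : (M⁻¹).PosSemidef := hM.inv.posSemidef
  set L : EuclideanSpace ℝ ι →L[ℝ] EuclideanSpace ℝ ι →L[ℝ] ℝ :=
    ((∫ ω : EuclideanSpace ℝ ι, exp (-(∑ p ∈ C, ∑ x ∈ cell p, w x (ω x + ψ₀ x))) ∂(multivariateGaussian 0 M⁻¹))⁻¹ •
          (∫ ω : EuclideanSpace ℝ ι, exp (-(∑ p ∈ C, ∑ x ∈ cell p, w x (ω x + ψ₀ x))) •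
            ((∑ p ∈ C, ∑ x ∈ cell p, (w'' x (ω x + ψ₀ x)) • ((EuclideanSpace.proj x : EuclideanSpace ℝ ι →L[ℝ] ℝ).smulRight
                (EuclideanSpace.proj x : EuclideanSpace ℝ ι →L[ℝ] ℝ))) -
              (∑ p ∈ C, ∑ x ∈ cell p, (w' x (ω x + ψ₀ x)) • (EuclideanSpace.proj x : EuclideanSpace ℝ ι →L[ℝ] ℝ)).smulRight
                (∑ p ∈ C, ∑ x ∈ cell p, (w' x (ω x + ψ₀ x)) • (EuclideanSpace.proj x : EuclideanSpace ℝ ι →L[ℝ] ℝ)))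
            ∂(multivariateGaussian 0 M⁻¹)) +
        (((∫ ω : EuclideanSpace ℝ ι, exp (-(∑ p ∈ C, ∑ x ∈ cell p, w x (ω x + ψ₀ x))) ∂(multivariateGaussian 0 M⁻¹)) ^ 2)⁻¹ •
          ∫ ω : EuclideanSpace ℝ ι, exp (-(∑ p ∈ C, ∑ x ∈ cell p, w x (ω x + ψ₀ x))) •
            (∑ p ∈ C, ∑ x ∈ cell p, (w' x (ω x + ψ₀ x)) • (EuclideanSpace.proj x : EuclideanSpace ℝ ι →L[ℝ] ℝ))
            ∂(multivariateGaussian 0 M⁻¹)).smulRight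
          (∫ ω : EuclideanSpace ℝ ι, exp (-(∑ p ∈ C, ∑ x ∈ cell p, w x (ω x + ψ₀ x))) •
            (∑ p ∈ C, ∑ x ∈ cell p, (w' x (ω x + ψ₀ x)) • (EuclideanSpace.proj x : EuclideanSpace ℝ ι →L[ℝ] ℝ))
            ∂(multivariateGaussian 0 M⁻¹))) with hL
  have hherm := symmMatrix_isHermitian (fun x y : ι => L (EuclideanSpace.single x (1 : ℝ)) (EuclideanSpace.single y (1 : ℝ)))
  have hform : ∀ z : ι → ℝ, z ⬝ᵥ (Matrix.of fun x y : ι => (L (EuclideanSpace.single x (1 : ℝ)) (EuclideanSpace.single y (1 : ℝ)) +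
      L (EuclideanSpace.single y (1 : ℝ)) (EuclideanSpace.single x (1 : ℝ))) / 2) *ᵥ z =
      L (WithLp.toLp 2 z) (WithLp.toLp 2 z) := fun z => symmMatrix_form_eq L (WithLp.toLp 2 z)
  refine ⟨hherm, letters_of_form_bounds hherm (fun z => ?_) (fun z => ?_)⟩
  · rw [hform z, hL]
    have hge := hessian_neg_log_step_ge hM hfl hΓop hdisj hw' hw'' hw'm hw''m hκ₀ hκ₁ hτ hδ hθ0 hθ1 hκθ hstab hw'b hw''b hlamw
      hwlo hm C ψ₀ (WithLp.toLp 2 z)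
    have hQ := cellSq_le_dotSelf cell hdisj C (WithLp.toLp 2 z)
    refine le_trans ?_ hge
    have h2 : 2 * lamw * ∑ p ∈ C, ∑ x ∈ cell p, (WithLp.toLp 2 z : EuclideanSpace ℝ ι) x ^ 2 ≤
        2 * lamw * ((WithLp.ofLp (WithLp.toLp 2 z : EuclideanSpace ℝ ι)) ⬝ᵥ (WithLp.ofLp (WithLp.toLp 2 z : EuclideanSpace ℝ ι))) :=
      mul_le_mul_of_nonneg_left hQ (by positivity)
    rw [WithLp.ofLp_toLp] at h2
    linarith
  · rw [hform z, hL]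
    have hle := hessian_neg_log_step_le hΓ hΓop hdisj hw' hw'' hw'm hw''m hκ₀ hκ₁ hτ hδ hθ0 hθ1 hκθ hκθ₆ hstab hquad hw'b hw''b
      hwup C ψ₀ (WithLp.toLp 2 z)
    have hQ := cellSq_le_dotSelf cell hdisj C (WithLp.toLp 2 z)
    rw [WithLp.ofLp_toLp] at hQ
    exact hle.trans (mul_le_mul_of_nonneg_left hQ hΛw)

end Road

/-! ## §3. Toy -/

/-- Toy (§1): the symmetrisation of any `f` is symmetric. -/
example (f : ι → ι → ℝ) : (Matrix.of fun x y : ι => (f x y + f y x) / 2).IsHermitian := symmMatrix_isHermitian f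

end Summit.QuantumFields.BalabanUV.T4Continuum.NE7b.SupNextHessianMatrix
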